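import Mathlib

/-!
# Tier4/Line4/HoloRegularity — several-variable regularity of holomorphic functions (free-standing, Mathlib-level)

Blind re-derivation cell `pub-hodge-repro`, Tier 4 (README §9–§10), seat t4-L4-p2 (prover, LINE L4, gen 0).  Tree
path `lean/Summits/Ventures/HodgeRepro/Tier4/Line4/HoloRegularity.lean`.  Imports Mathlib ONLY; nothing of the target
or of the line is used here — this is the analytic input the lead named for L4.2 `mixed_closed` (STATUS S12095: «the
several-variable regularity of a `DifferentiableOn ℂ` map on an open set of `ℂ²` is the step to supply — Osgood /
iterated Cauchy formula»), in the generality of `ι → ℂ` for a finite type `ι` (the sup norm makes balls polydiscs).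

WHAT IS PROVED (Mathlib has the one-variable theory only: `DifferentiableOn.analyticOnNhd` for `f : ℂ → E`; no
Osgood / Hartogs lemma).  For `u : (ι → ℂ) → ℂ` ℂ-differentiable on an open set `U`:
* `differentiableAt_pd` / `differentiableOn_pd`: every partial derivative `∂_i u = fun x => fderiv ℂ u x (Pi.single i 1)`
  is ℂ-differentiable on `U`.  Method: Cauchy's formula for the derivative on the coordinate slice
  `t ↦ u (x + t e_i)` (`DiffContOnCl.deriv_eq_smul_circleIntegral`, a one-variable holomorphic function on a disc),
  then differentiation under the circle integral (`hasFDerivAt_integral_of_dominated_of_fderiv_le`), dominated by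
  the first-order Cauchy estimate `‖fderiv ℂ u y‖ ≤ card ι · M / R` (`Complex.norm_deriv_le_of_forall_mem_sphere_norm_le`
  coordinatewise, `norm_fderiv_le`), the measurability of the integrand's derivative coming from `measurable_fderiv`.
* `differentiableAt_fderiv`: `fderiv ℂ u` is ℂ-differentiable on `U`; `pd_pd_symm`: the mixed second partials are
  symmetric, `∂_m ∂_k u = ∂_k ∂_m u` (Mathlib's `second_derivative_symmetric_of_eventually` over `𝕜 = ℂ`).
* `contDiffOn_of_differentiableOn` / `contDiffOn_real_of_differentiableOn`: `u` is `C^n` on `U` for every `n : ℕ`,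
  over `ℂ` and hence over `ℝ` (induction via `contDiffOn_succ_iff_fderiv_of_isOpen`, `fderiv ℂ u = Σ_j ∂_j u • proj_j`).

Nothing here says anything about the status of the Hodge conjecture for CM abelian varieties, which is NOT proved
(HC_CM is NOT proved by anyone in this repository).
-/

set_option autoImplicit false

noncomputable section

open Metric Set Filter Topology MeasureTheory
open scoped Real

namespace Summit.Ventures.HodgeRepro.Tier4.Line4.HoloReg

variable {ι : Type*} [Fintype ι] [DecidableEq ι]

/-- The slice has derivative `∂_i u` (chain rule along the affine line `t ↦ x + t e_i`). -/
theorem hasDerivAt_slice {u : (ι → ℂ) → ℂ} {x : ι → ℂ} {i : ι} {t : ℂ}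
    (hu : DifferentiableAt ℂ u (x + Pi.single i t)) :
    HasDerivAt (fun t => u (x + Pi.single i t)) (fderiv ℂ u (x + Pi.single i t) (Pi.single i 1)) t := by
  have hφ : HasDerivAt (fun s : ℂ => x + Pi.single i s) (Pi.single i (1 : ℂ)) t :=
    (hasDerivAt_single i t).const_add x
  exact hu.hasFDerivAt.comp_hasDerivAt t hφ

/-- `x + t e_i` lies in the closed polydisc of radius `‖t‖` about `x`. -/
theorem add_single_mem_closedBall {x : ι → ℂ} {r : ℝ} {i : ι} {t : ℂ} (ht : ‖t‖ ≤ r) :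
    x + Pi.single i t ∈ Metric.closedBall x r := by
  rw [mem_closedBall_iff_norm, add_sub_cancel_left, Pi.norm_single]
  exact ht

/-- The slice through `x` is holomorphic on the disc of radius `r` and continuous on its closure, when the closed
polydisc `Metric.closedBall x r` lies in the open set `U` on which `u` is holomorphic. -/
theorem diffContOnCl_slice {u : (ι → ℂ) → ℂ} {U : Set (ι → ℂ)} (hU : IsOpen U) (hu : DifferentiableOn ℂ u U)
    {x : ι → ℂ} {r : ℝ} (hr : 0 < r) (hx : Metric.closedBall x r ⊆ U) (i : ι) :
    DiffContOnCl ℂ (fun t => u (x + Pi.single i t)) (Metric.ball 0 r) := by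
  refine ⟨fun t ht => ?_, ?_⟩
  · rw [mem_ball, dist_zero_right] at ht
    have hmem : x + Pi.single i t ∈ U := hx (add_single_mem_closedBall ht.le)
    exact (hasDerivAt_slice (hu.differentiableAt (hU.mem_nhds hmem))).differentiableAt.differentiableWithinAt
  · rw [closure_ball 0 hr.ne']
    intro t ht
    rw [mem_closedBall, dist_zero_right] at ht
    have hmem : x + Pi.single i t ∈ U := hx (add_single_mem_closedBall ht)
    have hc : ContinuousAt u (x + Pi.single i t) := hu.continuousOn.continuousAt (hU.mem_nhds hmem)
    have hφ : ContinuousAt (fun s : ℂ => x + Pi.single i s) t :=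
      ((hasDerivAt_single i t).const_add x).continuousAt
    exact (ContinuousAt.comp_of_eq hc hφ rfl).continuousWithinAt

/-- The derivative of the slice at `0` is the partial derivative at `x`. -/
theorem deriv_slice_zero {u : (ι → ℂ) → ℂ} {x : ι → ℂ} (hu : DifferentiableAt ℂ u x) (i : ι) :
    deriv (fun t => u (x + Pi.single i t)) 0 = fderiv ℂ u x (Pi.single i 1) := by
  have h := hasDerivAt_slice (u := u) (x := x) (i := i) (t := 0) (by simpa using hu)
  simpa using h.deriv

/-- **Cauchy's formula for the partial derivative** on the coordinate slice. -/
theorem pd_eq_circleIntegral {u : (ι → ℂ) → ℂ} {U : Set (ι → ℂ)} (hU : IsOpen U)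
    (hu : DifferentiableOn ℂ u U) {x : ι → ℂ} {r : ℝ} (hr : 0 < r) (hx : Metric.closedBall x r ⊆ U) (i : ι) :
    fderiv ℂ u x (Pi.single i 1) = (2 * π * Complex.I)⁻¹ • ∮ ζ in C(0, r), (1 / ζ ^ 2) • (fun t => u (x + Pi.single i t)) ζ := by
  have h1 := (diffContOnCl_slice hU hu hr hx i).deriv_eq_smul_circleIntegral hr
  simp only [sub_zero] at h1
  have h2 : deriv (fun t => u (x + Pi.single i t)) 0 = fderiv ℂ u x (Pi.single i 1) :=
    deriv_slice_zero (hu.differentiableAt (hU.mem_nhds (hx (mem_closedBall_self hr.le)))) i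
  rw [h1, h2, smul_smul, inv_mul_cancel₀ Complex.two_pi_I_ne_zero, one_smul]

/-- **Cauchy's estimate for the partial derivative**: `‖∂_i u (x)‖ ≤ M / r` if `‖u‖ ≤ M` on the closed polydisc
of radius `r` about `x`. -/
theorem norm_pd_le {u : (ι → ℂ) → ℂ} {U : Set (ι → ℂ)} (hU : IsOpen U) (hu : DifferentiableOn ℂ u U)
    {x : ι → ℂ} {r : ℝ} (hr : 0 < r) (hx : Metric.closedBall x r ⊆ U) {M : ℝ}
    (hM : ∀ y ∈ Metric.closedBall x r, ‖u y‖ ≤ M) (i : ι) : ‖fderiv ℂ u x (Pi.single i 1)‖ ≤ M / r := by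
  rw [← deriv_slice_zero (hu.differentiableAt (hU.mem_nhds (hx (mem_closedBall_self hr.le)))) i]
  refine Complex.norm_deriv_le_of_forall_mem_sphere_norm_le hr (diffContOnCl_slice hU hu hr hx i)
    fun ζ hζ => hM _ ?_
  rw [mem_sphere, dist_zero_right] at hζ
  exact add_single_mem_closedBall hζ.le

/-- A continuous linear functional on `ι → ℂ` is bounded by the sum of the norms of its coefficients. -/
theorem norm_clm_le_sum_norm_single (L : (ι → ℂ) →L[ℂ] ℂ) : ‖L‖ ≤ ∑ j, ‖L (Pi.single j 1)‖ := by
  refine L.opNorm_le_bound (Finset.sum_nonneg fun j _ => norm_nonneg _) fun v => ?_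
  have hv : v = ∑ j, v j • (Pi.single j (1 : ℂ) : ι → ℂ) := by
    ext k
    simp [Finset.sum_apply, Pi.single_apply]
  calc ‖L v‖ = ‖∑ j, v j • L (Pi.single j 1)‖ := by
        conv_lhs => rw [hv]
        simp [map_sum, map_smul]
    _ ≤ ∑ j, ‖v j • L (Pi.single j 1)‖ := norm_sum_le _ _
    _ = ∑ j, ‖v j‖ * ‖L (Pi.single j 1)‖ := by simp
    _ ≤ ∑ j, ‖v‖ * ‖L (Pi.single j 1)‖ :=
        Finset.sum_le_sum fun j _ => mul_le_mul_of_nonneg_right (norm_le_pi_norm v j) (norm_nonneg _)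
    _ = (∑ j, ‖L (Pi.single j 1)‖) * ‖v‖ := by rw [← Finset.mul_sum, mul_comm]

/-- **Cauchy's estimate for the full derivative**: `‖fderiv ℂ u x‖ ≤ card ι · M / r`. -/
theorem norm_fderiv_le {u : (ι → ℂ) → ℂ} {U : Set (ι → ℂ)} (hU : IsOpen U) (hu : DifferentiableOn ℂ u U)
    {x : ι → ℂ} {r : ℝ} (hr : 0 < r) (hx : Metric.closedBall x r ⊆ U) {M : ℝ}
    (hM : ∀ y ∈ Metric.closedBall x r, ‖u y‖ ≤ M) : ‖fderiv ℂ u x‖ ≤ Fintype.card ι * (M / r) := by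
  calc ‖fderiv ℂ u x‖ ≤ ∑ j, ‖fderiv ℂ u x (Pi.single j 1)‖ := norm_clm_le_sum_norm_single _
    _ ≤ ∑ _j : ι, M / r := Finset.sum_le_sum fun j _ => norm_pd_le hU hu hr hx hM j
    _ = Fintype.card ι * (M / r) := by simp

/-- **The partial derivatives of a holomorphic function of several variables are holomorphic**: if `u` is
ℂ-differentiable on the open set `U`, then `∂_i u` is ℂ-differentiable at every point of `U`. -/
theorem differentiableAt_pd {u : (ι → ℂ) → ℂ} {U : Set (ι → ℂ)} (hU : IsOpen U)
    (hu : DifferentiableOn ℂ u U) {z : ι → ℂ} (hz : z ∈ U) (i : ι) : DifferentiableAt ℂ (fun y => fderiv ℂ u y (Pi.single i 1)) z := by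
  -- radii: `Metric.closedBall z R₀ ⊆ U`, `R = R₀ / 2` (bound on `fderiv`), `r = R / 2` (circle radius / neighbourhood)
  obtain ⟨ε, hε, hεU⟩ := Metric.isOpen_iff.1 hU z hz
  obtain ⟨M, hM⟩ := (isCompact_closedBall z (ε / 2)).exists_bound_of_continuousOn
    (hu.continuousOn.mono ((closedBall_subset_ball (by linarith)).trans hεU))
  set R : ℝ := ε / 4 with hR
  have hRpos : 0 < R := by positivity
  have hRU : Metric.closedBall z R ⊆ U := (closedBall_subset_ball (by linarith)).trans hεU
  set r : ℝ := R / 2 with hr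
  have hrpos : 0 < r := by positivity
  -- the Cauchy bound on the derivative on `Metric.closedBall z R`
  have hB : ∀ y ∈ Metric.closedBall z R, ‖fderiv ℂ u y‖ ≤ Fintype.card ι * (M / R) := by
    intro y hy
    have hyz : Metric.closedBall y R ⊆ Metric.closedBall z (ε / 2) :=
      closedBall_subset_closedBall' (by linarith [mem_closedBall.1 hy])
    exact norm_fderiv_le hU hu hRpos (hyz.trans ((closedBall_subset_ball (by linarith)).trans hεU))
      fun w hw => hM w (hyz hw)
  -- points of the circle through `x ∈ Metric.ball z r` lie in `Metric.closedBall z R`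
  have hpt : ∀ x ∈ Metric.ball z r, ∀ θ : ℝ, x + Pi.single i (circleMap 0 r θ) ∈ Metric.closedBall z R := by
    intro x hx θ
    have h1 : x + Pi.single i (circleMap 0 r θ) ∈ Metric.closedBall x r :=
      add_single_mem_closedBall (by rw [norm_circleMap_zero, abs_of_pos hrpos])
    exact closedBall_subset_closedBall' (by linarith [mem_ball.1 hx]) h1
  -- the integral representation on `Metric.ball z r`
  set F : (ι → ℂ) → ℝ → ℂ := fun x θ =>
    deriv (circleMap 0 r) θ • ((1 / circleMap 0 r θ ^ 2) • u (x + Pi.single i (circleMap 0 r θ))) with hF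
  set F' : (ι → ℂ) → ℝ → ((ι → ℂ) →L[ℂ] ℂ) := fun x θ =>
    deriv (circleMap 0 r) θ • ((1 / circleMap 0 r θ ^ 2) • fderiv ℂ u (x + Pi.single i (circleMap 0 r θ)))
    with hF'
  have hrep : ∀ x ∈ Metric.ball z r, fderiv ℂ u x (Pi.single i 1) =
      (2 * π * Complex.I)⁻¹ • ∫ θ, F x θ ∂(volume.restrict (Ioc 0 (2 * π))) := by
    intro x hx
    have hxr : Metric.closedBall x r ⊆ U :=
      (closedBall_subset_closedBall' (by linarith [mem_ball.1 hx])).trans hRU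
    rw [pd_eq_circleIntegral hU hu hrpos hxr i, circleIntegral,
      intervalIntegral.integral_of_le Real.two_pi_pos.le]
  -- continuity of the integrand in `θ`
  have hd : deriv (circleMap 0 r) = fun θ => circleMap 0 r θ * Complex.I := funext (deriv_circleMap 0 r)
  have hcm : Continuous fun θ : ℝ => circleMap 0 r θ := continuous_circleMap 0 r
  have hne : ∀ θ : ℝ, circleMap 0 r θ ≠ 0 := fun θ => circleMap_ne_center hrpos.ne'
  have hc1 : Continuous fun θ : ℝ => deriv (circleMap 0 r) θ := by
    rw [hd]; exact hcm.mul continuous_const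
  have hc2 : Continuous fun θ : ℝ => (1 / circleMap 0 r θ ^ 2 : ℂ) :=
    continuous_const.div (hcm.pow 2) fun θ => pow_ne_zero 2 (hne θ)
  have hcpt : ∀ x : ι → ℂ, Continuous fun θ : ℝ => x + Pi.single i (circleMap 0 r θ) :=
    fun x => continuous_const.add ((continuous_single i).comp hcm)
  have hFcont : ∀ x ∈ Metric.ball z r, Continuous (F x) := by
    intro x hx
    have hu' : Continuous fun θ : ℝ => u (x + Pi.single i (circleMap 0 r θ)) :=
      hu.continuousOn.comp_continuous (hcpt x) fun θ => hRU (hpt x hx θ)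
    exact hc1.smul (hc2.smul hu')
  -- differentiation under the integral sign
  have hkey : HasFDerivAt (fun x => ∫ θ, F x θ ∂(volume.restrict (Ioc 0 (2 * π))))
      (∫ θ, F' z θ ∂(volume.restrict (Ioc 0 (2 * π)))) z := by
    have hzr : z ∈ Metric.ball z r := mem_ball_self hrpos
    refine hasFDerivAt_integral_of_dominated_of_fderiv_le (𝕜 := ℂ) (s := Metric.ball z r)
      (bound := fun _ => r * ((1 / r ^ 2) * (Fintype.card ι * (M / R)))) (ball_mem_nhds z hrpos) ?_ ?_ ?_ ?_ ?_ ?_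
    · filter_upwards [ball_mem_nhds z hrpos] with x hx
      exact (hFcont x hx).aestronglyMeasurable
    · exact (hFcont z hzr).integrableOn_Ioc
    · haveI : ProperSpace ((ι → ℂ) →L[ℂ] ℂ) := FiniteDimensional.proper ℂ _
      have hm : Measurable fun θ : ℝ => fderiv ℂ u (z + Pi.single i (circleMap 0 r θ)) :=
        (measurable_fderiv ℂ u).comp (hcpt z).measurable
      exact hc1.aestronglyMeasurable.smul (hc2.aestronglyMeasurable.smul hm.aestronglyMeasurable)
    · refine Eventually.of_forall fun θ x hx => ?_
      simp only [hF', norm_smul, hd, norm_mul, Complex.norm_I, mul_one, norm_circleMap_zero, abs_of_pos hrpos,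
        norm_div, norm_one, norm_pow]
      gcongr
      exact hB _ (hpt x hx θ)
    · exact continuous_const.integrableOn_Ioc
    · refine Eventually.of_forall fun θ x hx => ?_
      have hdiff : HasFDerivAt (fun x : ι → ℂ => u (x + Pi.single i (circleMap 0 r θ)))
          (fderiv ℂ u (x + Pi.single i (circleMap 0 r θ))) x := by
        exact ((hu.differentiableAt (hU.mem_nhds (hRU (hpt x hx θ)))).hasFDerivAt.comp x
          ((hasFDerivAt_id x).add_const (Pi.single i (circleMap 0 r θ)))).congr_fderiv
          (ContinuousLinearMap.comp_id _)
      exact (hdiff.const_smul (1 / circleMap 0 r θ ^ 2)).const_smul (deriv (circleMap 0 r) θ)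
  -- conclude: `∂_i u` agrees with the integral formula near `z`
  have heq : (fun x => (2 * π * Complex.I)⁻¹ • ∫ θ, F x θ ∂(volume.restrict (Ioc 0 (2 * π)))) =ᶠ[𝓝 z] (fun x => fderiv ℂ u x (Pi.single i 1)) := by
    filter_upwards [ball_mem_nhds z hrpos] with x hx
    exact (hrep x hx).symm
  exact ((hkey.const_smul ((2 * π * Complex.I)⁻¹)).congr_of_eventuallyEq heq.symm).differentiableAt

/-- `∂_i u` is holomorphic on `U`. -/
theorem differentiableOn_pd {u : (ι → ℂ) → ℂ} {U : Set (ι → ℂ)} (hU : IsOpen U)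
    (hu : DifferentiableOn ℂ u U) (i : ι) : DifferentiableOn ℂ (fun y => fderiv ℂ u y (Pi.single i 1)) U :=
  fun _ hz => (differentiableAt_pd hU hu hz i).differentiableWithinAt

/-- A continuous linear functional on `ι → ℂ` is the sum of its coefficients times the coordinate projections. -/
theorem clm_eq_sum_single_smul_proj (L : (ι → ℂ) →L[ℂ] ℂ) :
    L = ∑ j, L (Pi.single j 1) • (ContinuousLinearMap.proj j : (ι → ℂ) →L[ℂ] ℂ) := by
  ext v
  have hv : v = ∑ j, v j • (Pi.single j (1 : ℂ) : ι → ℂ) := by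
    ext k
    simp [Finset.sum_apply, Pi.single_apply]
  conv_lhs => rw [hv]
  simp [map_sum, map_smul, mul_comm]

/-- The derivative of `u` is the sum of the partial derivatives times the coordinate projections. -/
theorem fderiv_eq_sum_pd_smul_proj (u : (ι → ℂ) → ℂ) :
    fderiv ℂ u = fun y => ∑ j, fderiv ℂ u y (Pi.single j 1) • (ContinuousLinearMap.proj j : (ι → ℂ) →L[ℂ] ℂ) :=
  funext fun y => clm_eq_sum_single_smul_proj (fderiv ℂ u y)

/-- **The derivative of a holomorphic function of several variables is holomorphic.** -/
theorem differentiableAt_fderiv {u : (ι → ℂ) → ℂ} {U : Set (ι → ℂ)} (hU : IsOpen U)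
    (hu : DifferentiableOn ℂ u U) {z : ι → ℂ} (hz : z ∈ U) : DifferentiableAt ℂ (fderiv ℂ u) z := by
  rw [fderiv_eq_sum_pd_smul_proj]
  exact DifferentiableAt.fun_sum fun j _ =>
    (differentiableAt_pd hU hu hz j).smul_const (ContinuousLinearMap.proj j : (ι → ℂ) →L[ℂ] ℂ)

omit [DecidableEq ι] in
/-- The derivative of `y ↦ fderiv ℂ u y v` in the direction `w` is the second derivative applied to `w`, then `v`. -/
theorem fderiv_fderiv_apply {u : (ι → ℂ) → ℂ} {z : ι → ℂ} (hu : DifferentiableAt ℂ (fderiv ℂ u) z) (v w : ι → ℂ) :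
    fderiv ℂ (fun y => fderiv ℂ u y v) z w = fderiv ℂ (fderiv ℂ u) z w v := by
  rw [(hu.hasFDerivAt.clm_apply (hasFDerivAt_const v z)).fderiv]
  simp

/-- **Symmetry of the mixed second partial derivatives** of a holomorphic function of several variables. -/
theorem pd_pd_symm {u : (ι → ℂ) → ℂ} {U : Set (ι → ℂ)} (hU : IsOpen U) (hu : DifferentiableOn ℂ u U)
    {z : ι → ℂ} (hz : z ∈ U) (k m : ι) : fderiv ℂ (fun y => fderiv ℂ u y (Pi.single k 1)) z (Pi.single m 1) = fderiv ℂ (fun y => fderiv ℂ u y (Pi.single m 1)) z (Pi.single k 1) := by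
  have hf' : ∀ᶠ y in 𝓝 z, HasFDerivAt u (fderiv ℂ u y) y := by
    filter_upwards [hU.mem_nhds hz] with y hy
    exact (hu.differentiableAt (hU.mem_nhds hy)).hasFDerivAt
  have hdf := differentiableAt_fderiv hU hu hz
  have hsymm := second_derivative_symmetric_of_eventually hf' hdf.hasFDerivAt (Pi.single m 1) (Pi.single k 1)
  show fderiv ℂ (fun y => fderiv ℂ u y (Pi.single k 1)) z (Pi.single m 1) =
    fderiv ℂ (fun y => fderiv ℂ u y (Pi.single m 1)) z (Pi.single k 1)
  rw [fderiv_fderiv_apply hdf, fderiv_fderiv_apply hdf, hsymm]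

/-- **A holomorphic function of several variables is `C^n` for every `n`** (over `ℂ`, hence over `ℝ`). -/
theorem contDiffOn_of_differentiableOn {U : Set (ι → ℂ)} (hU : IsOpen U) (n : ℕ) :
    ∀ u : (ι → ℂ) → ℂ, DifferentiableOn ℂ u U → ContDiffOn ℂ n u U := by
  induction n with
  | zero =>
    intro u hu
    exact contDiffOn_zero.2 hu.continuousOn
  | succ n ih =>
    intro u hu
    rw [Nat.cast_succ]
    refine (contDiffOn_succ_iff_fderiv_of_isOpen hU).2 ⟨hu, fun h => absurd h (by simp), ?_⟩
    rw [fderiv_eq_sum_pd_smul_proj]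
    exact ContDiffOn.sum fun j _ => (ih _ (differentiableOn_pd hU hu j)).smul contDiffOn_const

/-- The real `C^n`-regularity of a holomorphic function of several variables. -/
theorem contDiffOn_real_of_differentiableOn {u : (ι → ℂ) → ℂ} {U : Set (ι → ℂ)} (hU : IsOpen U)
    (hu : DifferentiableOn ℂ u U) (n : ℕ) : ContDiffOn ℝ n u U :=
  (contDiffOn_of_differentiableOn hU n u hu).restrict_scalars ℝ

end Summit.Ventures.HodgeRepro.Tier4.Line4.HoloReg

end
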